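import Mathlib
import Summits.PneNP.PneNP.Theorems.ConvexRankGatesConvexGateBlindPoolRecentre

/-!
# PneNP / ConvexRankGates — `ConvexGateBlind`: superset averaging over pools and over pool complements

Helpers (`--supports stmt-PneNP-10680`), COLUMN-SPACE line (prover seat 2, session 19); second brick of the unconditional
linear ℓ₁-bound. Instantiates the abstract superset-averaging identity `sum_poolRc_family` of `…PoolRecentre` for the two
families used by the pool measure: all `n`-subsets ("pools") of `U` through `x, y` (`sum_poolRc_pools`:
`∑ rc_P F(x,y) = C(u−2,n−2)·c(u,n)·rc_U F(x,y)`) and the complements of all pools avoiding `x, y`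
(`sum_poolRc_complements`: `∑ rc_{U∖P} F(x,y) = C(u−2,n)·c(u,u−n)·rc_U F(x,y)`), with the binomial bookkeeping. [new]
-/

set_option linter.dupNamespace false

namespace Summit.PneNP.PneNP.Theorems

open Finset

noncomputable section

variable {m : ℕ}

/-! ## Counting pools through / avoiding given vertices -/

/-- `n`-subsets of `U` avoiding a set `T ⊆ U` are the `n`-subsets of `U ∖ T`. [folklore] -/
theorem filter_powersetCard_avoid (U T : Finset (Fin m)) (n : ℕ) :
    (U.powersetCard n).filter (fun P => ∀ t ∈ T, t ∉ P) = (U \ T).powersetCard n := by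
  ext P
  simp only [Finset.mem_filter, Finset.mem_powersetCard, Finset.subset_sdiff, Finset.disjoint_right]
  tauto

/-- The number of `n`-subsets of `U` avoiding `T ⊆ U` is `C(#U − #T, n)`. [folklore] -/
theorem card_filter_powersetCard_avoid (U T : Finset (Fin m)) (hTU : T ⊆ U) (n : ℕ) :
    ((U.powersetCard n).filter (fun P => ∀ t ∈ T, t ∉ P)).card = (U.card - T.card).choose n := by
  rw [filter_powersetCard_avoid, Finset.card_powersetCard, Finset.card_sdiff_of_subset hTU]

/-- Binomial identity `(a+1)·C(a,b) = C(a+1,b+1)·(b+1)` in `ℝ`. [folklore] -/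
theorem cast_succ_mul_choose (a b : ℕ) :
    ((a : ℝ) + 1) * (a.choose b : ℝ) = ((a + 1).choose (b + 1) : ℝ) * ((b : ℝ) + 1) := by
  have h := Nat.add_one_mul_choose_eq a b
  have h' : ((a + 1 : ℕ) : ℝ) * (a.choose b : ℝ) = ((a + 1).choose (b + 1) : ℝ) * ((b + 1 : ℕ) : ℝ) := by
    exact_mod_cast h
  push_cast at h'
  exact h'

/-- Binomial identity `C(a,b)·(a+1) = C(a+1,b)·(a+1−b)` in `ℝ` (`b ≤ a + 1`). [folklore] -/
theorem cast_choose_mul_succ (a b : ℕ) (hb : b ≤ a + 1) :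
    (a.choose b : ℝ) * ((a : ℝ) + 1) = ((a + 1).choose b : ℝ) * ((a : ℝ) + 1 - b) := by
  have h := Nat.choose_mul_succ_eq a b
  have h' : ((a.choose b : ℕ) : ℝ) * ((a + 1 : ℕ) : ℝ) = (((a + 1).choose b : ℕ) : ℝ) * ((a + 1 - b : ℕ) : ℝ) := by
    exact_mod_cast h
  rw [Nat.cast_sub hb] at h'
  push_cast at h'
  exact h'

/-- **Superset averaging over all pools through `x, y`:**
`∑_{P ∈ C(U,n), x,y ∈ P} rc_P F(x,y) = C(u−2,n−2) · c(u,n) · rc_U F(x,y)` (`4 ≤ n ≤ u`). [new] -/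
theorem sum_poolRc_pools (U : Finset (Fin m)) (F : Fin m → Fin m → ℝ) (hF : ∀ a b, F a b = F b a)
    {x y : Fin m} (hxy : x ≠ y) (hx : x ∈ U) (hy : y ∈ U) {n : ℕ} (hn : 4 ≤ n) (hnU : n ≤ U.card) :
    ∑ P ∈ (U.powersetCard n).filter (fun P => x ∈ P ∧ y ∈ P), poolRc P F x y =
      ((U.card - 2).choose (n - 2) : ℝ) * poolCoef U.card n * poolRc U F x y := by
  classical
  set I := (U.powersetCard n).filter (fun P => x ∈ P ∧ y ∈ P) with hI
  -- superset counts
  have hcount : ∀ (B : Finset (Fin m)), B ⊆ U → B.card ≤ n →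
      (((U.powersetCard n).filter (fun P => B ⊆ P)).card : ℝ) = ((U.card - B.card).choose (n - B.card) : ℝ) := by
    intro B hBU hBn
    exact_mod_cast rb_card_filter_powersetCard_superset hBU hBn
  have hxy2 : ({x, y} : Finset (Fin m)).card = 2 := by
    rw [Finset.card_insert_of_notMem (by simpa using hxy), Finset.card_singleton]
  have hI' : I = (U.powersetCard n).filter (fun P => ({x, y} : Finset (Fin m)) ⊆ P) := by
    rw [hI]; refine Finset.filter_congr (fun P _ => ?_); simp [Finset.insert_subset_iff]
  have hN₀ : (I.card : ℝ) = ((U.card - 2).choose (n - 2) : ℝ) := by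
    rw [hI', hcount {x, y} (by simp [Finset.insert_subset_iff, hx, hy]) (by omega), hxy2]
  have hN₁ : ∀ z ∈ U, z ≠ x → z ≠ y → ((I.filter (fun P => z ∈ P)).card : ℝ) = ((U.card - 3).choose (n - 3) : ℝ) := by
    intro z hz hzx hzy
    have h3 : ({x, y, z} : Finset (Fin m)).card = 3 := by
      rw [Finset.card_insert_of_notMem (by simp [hxy, Ne.symm hzx]), Finset.card_insert_of_notMem (by simpa using Ne.symm hzy),
        Finset.card_singleton]
    have : I.filter (fun P => z ∈ P) = (U.powersetCard n).filter (fun P => ({x, y, z} : Finset (Fin m)) ⊆ P) := by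
      rw [hI, Finset.filter_filter]; refine Finset.filter_congr (fun P _ => ?_); simp [Finset.insert_subset_iff, and_assoc]
    rw [this, hcount {x, y, z} (by simp [Finset.insert_subset_iff, hx, hy, hz]) (by omega), h3]
  have hN₂ : ∀ z ∈ U, ∀ z' ∈ U, z ≠ x → z ≠ y → z' ≠ x → z' ≠ y → z ≠ z' →
      ((I.filter (fun P => z ∈ P ∧ z' ∈ P)).card : ℝ) = ((U.card - 4).choose (n - 4) : ℝ) := by
    intro z hz z' hz' hzx hzy hz'x hz'y hzz'
    have h4 : ({x, y, z, z'} : Finset (Fin m)).card = 4 := by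
      rw [Finset.card_insert_of_notMem (by simp [hxy, Ne.symm hzx, Ne.symm hz'x]),
        Finset.card_insert_of_notMem (by simp [Ne.symm hzy, Ne.symm hz'y]),
        Finset.card_insert_of_notMem (by simpa using hzz'), Finset.card_singleton]
    have : I.filter (fun P => z ∈ P ∧ z' ∈ P) =
        (U.powersetCard n).filter (fun P => ({x, y, z, z'} : Finset (Fin m)) ⊆ P) := by
      rw [hI, Finset.filter_filter]; refine Finset.filter_congr (fun P _ => ?_); simp [Finset.insert_subset_iff, and_assoc]
    rw [this, hcount {x, y, z, z'} (by simp [Finset.insert_subset_iff, hx, hy, hz, hz']) (by omega), h4]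
  -- binomial relations
  have hu4 : 4 ≤ U.card := le_trans hn hnU
  have h₁ : ((U.card : ℝ) - 2) * ((U.card - 3).choose (n - 3) : ℝ) = ((n : ℝ) - 2) * ((U.card - 2).choose (n - 2) : ℝ) := by
    have h := cast_succ_mul_choose (U.card - 3) (n - 3)
    have e1 : U.card - 3 + 1 = U.card - 2 := by omega
    have e2 : n - 3 + 1 = n - 2 := by omega
    rw [e1, e2] at h
    have c1 : ((U.card - 3 : ℕ) : ℝ) = (U.card : ℝ) - 3 := by rw [Nat.cast_sub (by omega)]; norm_num
    have c2 : ((n - 3 : ℕ) : ℝ) = (n : ℝ) - 3 := by rw [Nat.cast_sub (by omega)]; norm_num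
    rw [c1, c2] at h
    linear_combination h
  have h₂ : ((U.card : ℝ) - 3) * ((U.card - 4).choose (n - 4) : ℝ) = ((n : ℝ) - 3) * ((U.card - 3).choose (n - 3) : ℝ) := by
    have h := cast_succ_mul_choose (U.card - 4) (n - 4)
    have e1 : U.card - 4 + 1 = U.card - 3 := by omega
    have e2 : n - 4 + 1 = n - 3 := by omega
    rw [e1, e2] at h
    have c1 : ((U.card - 4 : ℕ) : ℝ) = (U.card : ℝ) - 4 := by rw [Nat.cast_sub (by omega)]; norm_num
    have c2 : ((n - 4 : ℕ) : ℝ) = (n : ℝ) - 4 := by rw [Nat.cast_sub (by omega)]; norm_num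
    rw [c1, c2] at h
    linear_combination h
  have hmem : ∀ P ∈ I, P ∈ U.powersetCard n ∧ x ∈ P ∧ y ∈ P := fun P hP => by
    simpa only [hI, Finset.mem_filter] using hP
  exact sum_poolRc_family I (fun P => P) U F hF hxy hx hy hn hnU
    (fun P hP => (Finset.mem_powersetCard.1 (hmem P hP).1).2) (fun P hP => (Finset.mem_powersetCard.1 (hmem P hP).1).1)
    (fun P hP => (hmem P hP).2.1) (fun P hP => (hmem P hP).2.2) _ _ _ hN₀ hN₁ hN₂ h₁ h₂

/-- **Superset averaging over the complements of all pools avoiding `x, y`:**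
`∑_{P ∈ C(U,n), x,y ∉ P} rc_{U∖P} F(x,y) = C(u−2,n) · c(u,u−n) · rc_U F(x,y)` (`n + 4 ≤ u`). [new] -/
theorem sum_poolRc_complements (U : Finset (Fin m)) (F : Fin m → Fin m → ℝ) (hF : ∀ a b, F a b = F b a)
    {x y : Fin m} (hxy : x ≠ y) (hx : x ∈ U) (hy : y ∈ U) {n : ℕ} (hnU : n + 4 ≤ U.card) :
    ∑ P ∈ (U.powersetCard n).filter (fun P => x ∉ P ∧ y ∉ P), poolRc (U \ P) F x y =
      ((U.card - 2).choose n : ℝ) * poolCoef U.card ((U.card : ℝ) - n) * poolRc U F x y := by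
  classical
  set I := (U.powersetCard n).filter (fun P => x ∉ P ∧ y ∉ P) with hI
  have hcount : ∀ (T : Finset (Fin m)), T ⊆ U →
      (((U.powersetCard n).filter (fun P => ∀ t ∈ T, t ∉ P)).card : ℝ) = ((U.card - T.card).choose n : ℝ) := by
    intro T hTU
    exact_mod_cast card_filter_powersetCard_avoid U T hTU n
  have hxy2 : ({x, y} : Finset (Fin m)).card = 2 := by
    rw [Finset.card_insert_of_notMem (by simpa using hxy), Finset.card_singleton]
  have hI' : I = (U.powersetCard n).filter (fun P => ∀ t ∈ ({x, y} : Finset (Fin m)), t ∉ P) := by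
    rw [hI]; refine Finset.filter_congr (fun P _ => ?_); simp
  have hN₀ : (I.card : ℝ) = ((U.card - 2).choose n : ℝ) := by
    rw [hI', hcount {x, y} (by simp [Finset.insert_subset_iff, hx, hy]), hxy2]
  have hmemI : ∀ P, P ∈ I ↔ (P ⊆ U ∧ P.card = n) ∧ x ∉ P ∧ y ∉ P := fun P => by
    rw [hI, Finset.mem_filter, Finset.mem_powersetCard]
  have hN₁ : ∀ z ∈ U, z ≠ x → z ≠ y → ((I.filter (fun P => z ∈ U \ P)).card : ℝ) = ((U.card - 3).choose n : ℝ) := by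
    intro z hz hzx hzy
    have h3 : ({x, y, z} : Finset (Fin m)).card = 3 := by
      rw [Finset.card_insert_of_notMem (by simp [hxy, Ne.symm hzx]), Finset.card_insert_of_notMem (by simpa using Ne.symm hzy),
        Finset.card_singleton]
    have : I.filter (fun P => z ∈ U \ P) = (U.powersetCard n).filter (fun P => ∀ t ∈ ({x, y, z} : Finset (Fin m)), t ∉ P) := by
      rw [hI, Finset.filter_filter]; refine Finset.filter_congr (fun P _ => ?_); simp [Finset.mem_sdiff, hz, and_assoc]
    rw [this, hcount {x, y, z} (by simp [Finset.insert_subset_iff, hx, hy, hz]), h3]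
  have hN₂ : ∀ z ∈ U, ∀ z' ∈ U, z ≠ x → z ≠ y → z' ≠ x → z' ≠ y → z ≠ z' →
      ((I.filter (fun P => z ∈ U \ P ∧ z' ∈ U \ P)).card : ℝ) = ((U.card - 4).choose n : ℝ) := by
    intro z hz z' hz' hzx hzy hz'x hz'y hzz'
    have h4 : ({x, y, z, z'} : Finset (Fin m)).card = 4 := by
      rw [Finset.card_insert_of_notMem (by simp [hxy, Ne.symm hzx, Ne.symm hz'x]),
        Finset.card_insert_of_notMem (by simp [Ne.symm hzy, Ne.symm hz'y]),
        Finset.card_insert_of_notMem (by simpa using hzz'), Finset.card_singleton]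
    have : I.filter (fun P => z ∈ U \ P ∧ z' ∈ U \ P) =
        (U.powersetCard n).filter (fun P => ∀ t ∈ ({x, y, z, z'} : Finset (Fin m)), t ∉ P) := by
      rw [hI, Finset.filter_filter]; refine Finset.filter_congr (fun P _ => ?_); simp [Finset.mem_sdiff, hz, hz', and_assoc]
    rw [this, hcount {x, y, z, z'} (by simp [Finset.insert_subset_iff, hx, hy, hz, hz']), h4]
  -- binomial relations, `w = u − n`
  have hw : ((U.card - n : ℕ) : ℝ) = (U.card : ℝ) - n := by rw [Nat.cast_sub (by omega)]
  have h₁ : ((U.card : ℝ) - 2) * ((U.card - 3).choose n : ℝ) = (((U.card - n : ℕ) : ℝ) - 2) * ((U.card - 2).choose n : ℝ) := by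
    have h := cast_choose_mul_succ (U.card - 3) n (by omega)
    have e1 : U.card - 3 + 1 = U.card - 2 := by omega
    rw [e1] at h
    have c1 : ((U.card - 3 : ℕ) : ℝ) = (U.card : ℝ) - 3 := by rw [Nat.cast_sub (by omega)]; norm_num
    rw [c1] at h
    rw [hw]
    linear_combination h
  have h₂ : ((U.card : ℝ) - 3) * ((U.card - 4).choose n : ℝ) = (((U.card - n : ℕ) : ℝ) - 3) * ((U.card - 3).choose n : ℝ) := by
    have h := cast_choose_mul_succ (U.card - 4) n (by omega)
    have e1 : U.card - 4 + 1 = U.card - 3 := by omega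
    rw [e1] at h
    have c1 : ((U.card - 4 : ℕ) : ℝ) = (U.card : ℝ) - 4 := by rw [Nat.cast_sub (by omega)]; norm_num
    rw [c1] at h
    rw [hw]
    linear_combination h
  have hres := sum_poolRc_family I (fun P => U \ P) U F hF hxy hx hy (w := U.card - n) (by omega) (by omega)
    (fun P hP => by
      have h := (hmemI P).1 hP
      rw [Finset.card_sdiff_of_subset h.1.1, h.1.2])
    (fun P _ => Finset.sdiff_subset) (fun P hP => Finset.mem_sdiff.2 ⟨hx, ((hmemI P).1 hP).2.1⟩)
    (fun P hP => Finset.mem_sdiff.2 ⟨hy, ((hmemI P).1 hP).2.2⟩) _ _ _ hN₀ hN₁ hN₂ h₁ h₂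
  rw [hres, hw]

/-- Pools through `x`: `#{P ∈ C(U,n) : x ∈ P} = C(u−1,n−1)` (`x ∈ U`, `1 ≤ n`). [folklore] -/
theorem card_pools_mem (U : Finset (Fin m)) {x : Fin m} (hx : x ∈ U) {n : ℕ} (hn : 1 ≤ n) :
    ((U.powersetCard n).filter (fun P => x ∈ P)).card = (U.card - 1).choose (n - 1) := by
  classical
  have h := rb_card_filter_powersetCard_superset (B := {x}) (U := U) (by simpa using hx) (c := n) (by simpa using hn)
  simp only [Finset.singleton_subset_iff, Finset.card_singleton] at h
  exact h

/-- Pools avoiding `x`: `#{P ∈ C(U,n) : x ∉ P} = C(u−1,n)` (`x ∈ U`). [folklore] -/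
theorem card_pools_not_mem (U : Finset (Fin m)) {x : Fin m} (hx : x ∈ U) (n : ℕ) :
    ((U.powersetCard n).filter (fun P => x ∉ P)).card = (U.card - 1).choose n := by
  classical
  have h := card_filter_powersetCard_avoid U {x} (by simpa using hx) n
  simp only [Finset.mem_singleton, forall_eq, Finset.card_singleton] at h
  exact h

/-- `u·C(u−1,n−1) = n·C(u,n)` in `ℝ` (`1 ≤ n ≤ u`). [folklore] -/
theorem cast_mul_choose_predSub (u n : ℕ) (hn : 1 ≤ n) (hnu : n ≤ u) :
    (u : ℝ) * ((u - 1).choose (n - 1) : ℝ) = (n : ℝ) * (u.choose n : ℝ) := by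
  have h := cast_succ_mul_choose (u - 1) (n - 1)
  have e1 : u - 1 + 1 = u := by omega
  have e2 : n - 1 + 1 = n := by omega
  rw [e1, e2] at h
  have c1 : ((u - 1 : ℕ) : ℝ) = (u : ℝ) - 1 := by rw [Nat.cast_sub (by omega)]; norm_num
  have c2 : ((n - 1 : ℕ) : ℝ) = (n : ℝ) - 1 := by rw [Nat.cast_sub hn]; norm_num
  rw [c1, c2] at h
  linear_combination h

/-- `u·C(u−1,n) = (u−n)·C(u,n)` in `ℝ` (`n ≤ u`, `1 ≤ u`). [folklore] -/
theorem cast_mul_choose_predCompl (u n : ℕ) (hu : 1 ≤ u) (hnu : n ≤ u) :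
    (u : ℝ) * ((u - 1).choose n : ℝ) = ((u : ℝ) - n) * (u.choose n : ℝ) := by
  have h := cast_choose_mul_succ (u - 1) n (by omega)
  have e1 : u - 1 + 1 = u := by omega
  rw [e1] at h
  have c1 : ((u - 1 : ℕ) : ℝ) = (u : ℝ) - 1 := by rw [Nat.cast_sub hu]; norm_num
  rw [c1] at h
  linear_combination h


/-- Pools through `x` avoiding `y`: `#{P ∈ C(U,n) : x ∈ P, y ∉ P} = C(u−2,n−1)` (`x ≠ y ∈ U`, `2 ≤ n`). [folklore] -/
theorem card_pools_mem_not_mem (U : Finset (Fin m)) {x y : Fin m} (hxy : x ≠ y) (hx : x ∈ U) (hy : y ∈ U) {n : ℕ}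
    (hn : 2 ≤ n) (hnU : n ≤ U.card) :
    ((U.powersetCard n).filter (fun P => x ∈ P ∧ y ∉ P)).card = (U.card - 2).choose (n - 1) := by
  classical
  -- `#{x ∈ P} = #{x,y ∈ P} + #{x ∈ P, y ∉ P}` and Pascal
  have hsplit := Finset.card_filter_add_card_filter_not (s := (U.powersetCard n).filter (fun P => x ∈ P))
    (fun P => y ∈ P)
  rw [Finset.filter_filter, Finset.filter_filter, card_pools_mem U hx (by omega)] at hsplit
  have hxy2 : ({x, y} : Finset (Fin m)).card = 2 := by
    rw [Finset.card_insert_of_notMem (by simpa using hxy), Finset.card_singleton]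
  have hboth : ((U.powersetCard n).filter (fun P => x ∈ P ∧ y ∈ P)).card = (U.card - 2).choose (n - 2) := by
    have h := rb_card_filter_powersetCard_superset (B := {x, y}) (U := U)
      (by simp [Finset.insert_subset_iff, hx, hy]) (c := n) (by rw [hxy2]; omega)
    rw [hxy2] at h
    rw [← h]
    congr 1
    refine Finset.filter_congr (fun P _ => ?_)
    simp [Finset.insert_subset_iff]
  rw [hboth] at hsplit
  have hpascal : (U.card - 1).choose (n - 1) = (U.card - 2).choose (n - 2) + (U.card - 2).choose (n - 1) := by
    have e1 : U.card - 1 = (U.card - 2) + 1 := by omega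
    have e2 : n - 1 = (n - 2) + 1 := by omega
    rw [e1, e2, Nat.choose_succ_succ]
  omega

/-- `u(u−1)·C(u−2,n−2) = n(n−1)·C(u,n)` in `ℝ` (`2 ≤ n ≤ u`). [folklore] -/
theorem cast_choose_sub_two (u n : ℕ) (hn : 2 ≤ n) (hnu : n ≤ u) :
    (u : ℝ) * ((u : ℝ) - 1) * ((u - 2).choose (n - 2) : ℝ) = (n : ℝ) * ((n : ℝ) - 1) * (u.choose n : ℝ) := by
  have hA := cast_mul_choose_predSub u n (by omega) hnu
  have hB := cast_mul_choose_predSub (u - 1) (n - 1) (by omega) (by omega)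
  have e1 : u - 1 - 1 = u - 2 := by omega
  have e2 : n - 1 - 1 = n - 2 := by omega
  rw [e1, e2] at hB
  have c1 : ((u - 1 : ℕ) : ℝ) = (u : ℝ) - 1 := by rw [Nat.cast_sub (by omega)]; norm_num
  have c2 : ((n - 1 : ℕ) : ℝ) = (n : ℝ) - 1 := by rw [Nat.cast_sub (by omega)]; norm_num
  rw [c1, c2] at hB
  linear_combination (u : ℝ) * hB + ((n : ℝ) - 1) * hA

/-- `u(u−1)·C(u−2,n−1) = n(u−n)·C(u,n)` in `ℝ` (`1 ≤ n ≤ u`, `2 ≤ u`). [folklore] -/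
theorem cast_choose_sub_two' (u n : ℕ) (hn : 1 ≤ n) (hnu : n ≤ u) (hu : 2 ≤ u) :
    (u : ℝ) * ((u : ℝ) - 1) * ((u - 2).choose (n - 1) : ℝ) = (n : ℝ) * ((u : ℝ) - n) * (u.choose n : ℝ) := by
  have hA := cast_mul_choose_predSub u n hn hnu
  have hB := cast_mul_choose_predCompl (u - 1) (n - 1) (by omega) (by omega)
  have e1 : u - 1 - 1 = u - 2 := by omega
  rw [e1] at hB
  have c1 : ((u - 1 : ℕ) : ℝ) = (u : ℝ) - 1 := by rw [Nat.cast_sub (by omega)]; norm_num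
  have c2 : ((n - 1 : ℕ) : ℝ) = (n : ℝ) - 1 := by rw [Nat.cast_sub hn]; norm_num
  rw [c1, c2] at hB
  linear_combination (u : ℝ) * hB + ((u : ℝ) - n) * hA

/-- `u(u−1)·C(u−2,n) = (u−n)(u−n−1)·C(u,n)` in `ℝ` (`n ≤ u`, `2 ≤ u`). [folklore] -/
theorem cast_choose_sub_two'' (u n : ℕ) (hnu : n ≤ u) (hu : 2 ≤ u) :
    (u : ℝ) * ((u : ℝ) - 1) * ((u - 2).choose n : ℝ) = ((u : ℝ) - n) * ((u : ℝ) - n - 1) * (u.choose n : ℝ) := by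
  have hA := cast_mul_choose_predCompl u n (by omega) hnu
  rcases eq_or_lt_of_le hnu with heq | hlt
  · -- `n = u`: both sides vanish
    subst heq
    have : ((n - 2).choose n : ℝ) = 0 := by exact_mod_cast Nat.choose_eq_zero_of_lt (by omega)
    rw [this]; ring
  · have hB := cast_mul_choose_predCompl (u - 1) n (by omega) (by omega)
    have e1 : u - 1 - 1 = u - 2 := by omega
    rw [e1] at hB
    have c1 : ((u - 1 : ℕ) : ℝ) = (u : ℝ) - 1 := by rw [Nat.cast_sub (by omega)]; norm_num
    rw [c1] at hB
    linear_combination (u : ℝ) * hB + ((u : ℝ) - n - 1) * hA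

/-- Pools through `x` and `y`: `#{P ∈ C(U,n) : x, y ∈ P} = C(u−2,n−2)` (`x ≠ y ∈ U`, `2 ≤ n`). [folklore] -/
theorem card_pools_mem_mem (U : Finset (Fin m)) {x y : Fin m} (hxy : x ≠ y) (hx : x ∈ U) (hy : y ∈ U) {n : ℕ}
    (hn : 2 ≤ n) :
    ((U.powersetCard n).filter (fun P => x ∈ P ∧ y ∈ P)).card = (U.card - 2).choose (n - 2) := by
  classical
  have hxy2 : ({x, y} : Finset (Fin m)).card = 2 := by
    rw [Finset.card_insert_of_notMem (by simpa using hxy), Finset.card_singleton]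
  have h := rb_card_filter_powersetCard_superset (B := {x, y}) (U := U)
    (by simp [Finset.insert_subset_iff, hx, hy]) (c := n) (by rw [hxy2]; omega)
  rw [hxy2] at h
  rw [← h]
  congr 1
  refine Finset.filter_congr (fun P _ => ?_)
  simp [Finset.insert_subset_iff]

/-- Pools avoiding `x` and `y`: `#{P ∈ C(U,n) : x, y ∉ P} = C(u−2,n)` (`x ≠ y ∈ U`). [folklore] -/
theorem card_pools_not_mem_not_mem (U : Finset (Fin m)) {x y : Fin m} (hxy : x ≠ y) (hx : x ∈ U) (hy : y ∈ U) (n : ℕ) :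
    ((U.powersetCard n).filter (fun P => x ∉ P ∧ y ∉ P)).card = (U.card - 2).choose n := by
  classical
  have hxy2 : ({x, y} : Finset (Fin m)).card = 2 := by
    rw [Finset.card_insert_of_notMem (by simpa using hxy), Finset.card_singleton]
  have h := card_filter_powersetCard_avoid U {x, y} (by simp [Finset.insert_subset_iff, hx, hy]) n
  rw [hxy2] at h
  rw [← h]
  congr 1
  refine Finset.filter_congr (fun P _ => ?_)
  simp

/-- **Superset averaging over pools** (registered form of `sum_poolRc_pools`). [new] -/
theorem superset_averaging_pools : ∀ {m : ℕ} (U : Finset (Fin m)) (F : Fin m → Fin m → ℝ), (∀ a b, F a b = F b a) → ∀ {x y : Fin m}, x ≠ y → x ∈ U → y ∈ U → ∀ {n : ℕ}, 4 ≤ n → n ≤ U.card → ∑ P ∈ (U.powersetCard n).filter (fun P => x ∈ P ∧ y ∈ P), poolRc P F x y = ((U.card - 2).choose (n - 2) : ℝ) * poolCoef U.card n * poolRc U F x y :=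
  fun U F hF _ _ hxy hx hy _ hn hnU => sum_poolRc_pools U F hF hxy hx hy hn hnU

end

end Summit.PneNP.PneNP.Theorems
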